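import Summits.ABC.IUTFork.Repair.ScalarShellsThm311
import HarnessLib

/-!
# IUT REPAIR branch (rung LADDER-ABC:A2.RP) — LAYER 2b over the SCALING shells: the data with the ZERO REGION admissible
# (so that per-row settings may put a one-point frame / the glue `{0}` at the junk label `0`)

MODEL DATA (toy definitions + folklore lemmas; no `Prop` fact) by abc-iut-w4-d098 (gen 3), the one builder of the scaling-shells model
(abc-iut-rp-plan RULINGS #11 (1)), answering abc-iut-rp-j1's kernel heads-up 2026-08-26T07:28:46Z: over `scalingShells p` the group
`⟨(Ind1) ∪ (Ind2)⟩` contains families that rescale the label-`0` packet ONLY; the star action `Φ • X` never reads label `0`; hence the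
equivariance clause (hρ) of the two-pin predicate forces a region operator to take a SCALE-INVARIANT value at label `0` — never a ball —
while `Setting.hul_adm` / `qRegion_mem` force the label-`0` glue to be an ADMISSIBLE hull-set. With `ScalarShellsThm311.sData` (admissible =
balls) the two cannot be met together. FIX (rp-j1's option (i), chosen by the bed owner): the SAME data with the zero region `{0}` declared
admissible as well (`Adm j vQ A := A = {0} ∨ ∃ k, A = B_k`), columns to match; `{0}` is fixed by every linear packet automorphism
(`image_zero_eq`), so a per-row setting can take frame `Hul ∋ {0}`, glue `{0}` and `ρ X 0 vQ := {0}` at label `0` and balls on `𝔽_l^⋇`.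
TAKES NO SIDE on [IUTchIII] Cor. 3.12; toys over abc-iut-c312-7's `toyIndex`.

CONTENT: `sData₀`, `sSituation₀`, `sColumn₀`, `sFull₀ p : FullSituation toyIndex`, **`sFull₀_statement`** (typed Thm. 3.11 (i)–(iii) holds),
`logvol_not_invariant₀` (Step (x) still fails on balls), `map_sFamDep_mem_RLGP₀`, **`exists_mem_RLGP₀_Psi_eq_qDatum`** (an element of
`^{n,∘}ℜ^LGP` whose splitting monoid is abc-iut-w4-d101's `qDatum` — via `ScalarShellsThm311.map_cQ_Psi`), `image_zero_eq`, `sData₀_adm_zero`,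
`sData₀_adm_sBall`. [claim: Mochizuki2012, status: disputed]
-/

noncomputable section

open Set

namespace Summit.ABC.IUTFork.Repair.ScalarShellsThm311Zero

open Thm311 Cor312 Cor312.Checks Cor312.IdentifiedNonVacuity Cor312Vol.NaiveWitness Cor312Vol.UnitWitness Cor312Vol.PinnedWitness
  Literature.IUT.LogThetaLattice Summit.ABC.IUTFork.Repair.ScalarShells Summit.ABC.IUTFork.Repair.ScalarShellsThm311

variable (p : ℕ) [hp : Fact p.Prime]

/-! ## 1. `{0}` is fixed by every packet automorphism -/

omit hp in
/-- A linear automorphism of a packet maps the zero region `{0}` onto itself. [folklore] -/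
theorem image_zero_eq {j : toyIndex.Label} {vQ : toyIndex.VQ}
    (Φ : (scalingShells p).Packet j vQ ≃ₗ[ℚ] (scalingShells p).Packet j vQ) :
    Φ '' ({0} : Set ((scalingShells p).Packet j vQ)) = {0} := by
  rw [Set.image_singleton, map_zero]

/-! ## 2. The data with `{0}` admissible, situation, columns, full situation -/

omit hp in
/-- **The data (a)(b)(c) with the zero region admissible**: as `ScalarShellsThm311.sData` (integral structures `B_0`, log-volume `sVol`,
splitting monoid `Ψ`, whole global packet) except `Adm j vQ A := A = {0} ∨ ∃ k, A = B_k`. [claim: Mochizuki2012, status: disputed] -/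
def sData₀ : MRData (scalingShells p) where
  shellPk := fun j vQ => sBall p ⊤ j vQ 0
  shellSub := fun j v => sBall p ⊤ j (toyIndex.over v) 0
  Adm := fun j vQ A => A = {0} ∨ ∃ k, A = sBall p ⊤ j vQ k
  logvol := fun j vQ A => sVol p ⊤ j vQ A
  Ψ := fun v _ => Psi p v
  act := fun v _ y => LinearMap.pi fun j => (line j.1 (toyIndex.over v) (y j)) • LinearMap.proj j
  Mmod := fun _ => Set.univ

omit hp in
/-- `{0}` is admissible for `sData₀`. [folklore] -/
theorem sData₀_adm_zero (j : toyIndex.Label) (vQ : toyIndex.VQ) : (sData₀ p).Adm j vQ {0} := Or.inl rfl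

omit hp in
/-- Every ball is admissible for `sData₀`. [folklore] -/
theorem sData₀_adm_sBall (j : toyIndex.Label) (vQ : toyIndex.VQ) (k : ℤ) : (sData₀ p).Adm j vQ (sBall p ⊤ j vQ k) := Or.inr ⟨k, rfl⟩

omit hp in
/-- The situation: scaling shells, `sData₀` on every line. An `abbrev`. [claim: Mochizuki2012, status: disputed] -/
abbrev sSituation₀ : Situation toyIndex where
  L := scalingShells p
  D := fun _ => sData₀ p
  G := fun _ j => sDegrees p j

omit hp in
/-- The column `n` matching `sData₀` (Frobenius-like admissibility := admissibility of the `(−1)^m`-twisted region). [claim: Mochizuki2012, status: disputed] -/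
def sColumn₀ : Column (scalingShells p) where
  frobAdm := fun m j vQ A => (twist m : (scalingShells p).PacketAut) j vQ '' A = {0} ∨
    ∃ k, (twist m : (scalingShells p).PacketAut) j vQ '' A = sBall p ⊤ j vQ k
  frobLogvol := fun m j vQ A => sVol p ⊤ j vQ ((twist m : (scalingShells p).PacketAut) j vQ '' A)
  frobΨ := fun m v _ => (scalingShells p).starAut (twist m) v '' Psi p v
  frobMmod := fun m j => (scalingShells p).globalAut (twist m) j.1 '' Set.univ
  unitImage := fun _ m' j vQ => sBall p ⊤ j vQ ((m' : ℤ) + 1)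
  ballImage := fun _ j vQ => sBall p ⊤ j vQ 0
  ObjLGP := ℤ
  frobObjLGP := FrobObj
  kumLGP := kum
  ObjLgp := ℤ
  frobObjLgp := FrobObj
  kumLgp := kum
  thetaPilot := fun m => ⟨(1, m), rfl⟩

omit hp in
/-- **The full situation with `{0}` admissible** (link data `naiveLink`). An `abbrev`. [claim: Mochizuki2012, status: disputed] -/
abbrev sFull₀ : FullSituation toyIndex where
  toSituation := sSituation₀ p
  col := fun _ => sColumn₀ p
  link := naiveLink

/-! ## 3. The typed Theorem 3.11 holds -/

/-- (i). [folklore] -/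
theorem s0_partI : (sFull₀ p).PartI := by
  refine ⟨fun n v hv x _ j => ?_, fun n j k => ⟨fun vQ => Or.inr ⟨k, rfl⟩, Set.toFinite _, ?_⟩, fun _ _ => rfl⟩
  · show x j ∈ signShells.SubPacket j.1 v
    rw [subPacket_eq_top]; trivial
  · rw [finsum_unique]
    exact (sVol_sBall p ⊤ j.1 _ k).symm

omit hp in
/-- (ii) (b) KummerB. [folklore] -/
theorem sColumn₀_kummerB (n : ℤ) : ((sFull₀ p).col n).KummerB ((sFull₀ p).D n) := fun m v _ =>
  image_Psi_of_actsBySigns p (twist_actsBySigns m) v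

omit hp in
/-- (ii): KummerA on `{0}` (fixed by the twist) and on balls (fixed by the twist), KummerB, KummerC, (Ind3). [folklore] -/
theorem s0_partII : (sFull₀ p).toLatticeSituation.PartII := by
  intro n
  refine (Column.partII_iff _ _).2 ⟨?_, sColumn₀_kummerB p n,
    fun m j => Set.image_univ_of_surjective ((scalingShells p).globalAut (twist m) j.1).surjective, ?_⟩
  · rintro m j vQ A (rfl | ⟨k, rfl⟩)
    · exact ⟨Or.inl (image_zero_eq p _), congrArg (sVol p ⊤ j vQ) (image_zero_eq p _)⟩
    · exact ⟨Or.inr ⟨k, image_sBall_twist p m j vQ k⟩, congrArg (sVol p ⊤ j vQ) (image_sBall_twist p m j vQ k)⟩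
  · refine ⟨fun m m' j vQ _ => sBall_mono p ⊤ j vQ (by omega), fun m j vQ h => absurd trivial h⟩

/-- (iii): as in the naive model. [folklore] -/
theorem s0_partIII : (sFull₀ p).PartIII := by
  refine ⟨naiveLink.partIIIa_holds, naiveLink.partIIIb_holds, ?_, ?_,
    (sFull₀ p).evalCompatUpToInd_of_multiradialCompat (s0_partI p).2.2⟩
  · refine naiveLink.partIIIc_of_full (fun _ => rfl) fun n m => ?_
    rintro _ ⟨a, rfl⟩
    show unitIso a ≪≫ unitIso ((-1) ^ m.natAbs) = unitIso ((-1) ^ m.natAbs) ≪≫ unitIso a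
    rw [unitIso_trans, unitIso_trans, mul_comm]
  · intro n m; exact Thm311.PolyIsoCalc.stabilized_full _ _

/-- **The typed [IUTchIII] Theorem 3.11 (i) ∧ (ii) ∧ (iii) HOLDS for `sFull₀`.** [folklore] -/
theorem sFull₀_statement : (sFull₀ p).Statement := ⟨s0_partI p, s0_partII p, s0_partIII p⟩

omit hp in
/-- The line-`n` data and its splitting monoid; the column Kummer image is `Ψ` at every `(n, m)`. [folklore] -/
theorem sFull₀_D_frobΨ (n m : ℤ) :
    (sFull₀ p).D n = sData₀ p ∧ ((sFull₀ p).D n).Ψ = (fun v _ => Psi p v) ∧ ((sFull₀ p).col n).frobΨ m = fun v _ => Psi p v :=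
  ⟨rfl, rfl, funext fun v => funext fun hv => sColumn₀_kummerB p n m v hv⟩

/-! ## 4. Step (x) still fails; the q-datum is still an `^{n,∘}ℜ^LGP`-splitting monoid -/

/-- **Step (x) log-volume invariance FAILS** for `sData₀` as well (balls are admissible and `sFam p` changes their volume). [folklore] -/
theorem logvol_not_invariant₀ (j : toyIndex.Label) (vQ : toyIndex.VQ) (k : ℤ) :
    ∃ Φ ∈ Subgroup.closure ((scalingShells p).Ind1Family ∪ (scalingShells p).Ind2Family),
      (sData₀ p).Adm j vQ (sBall p ⊤ j vQ k) ∧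
        (sData₀ p).logvol j vQ (Φ j vQ '' sBall p ⊤ j vQ k) ≠ (sData₀ p).logvol j vQ (sBall p ⊤ j vQ k) :=
  ⟨sFam p ⊤ (pUnit p), sFam_mem_closure p ⊤ (pUnit_mem_top p), sData₀_adm_sBall p j vQ k,
    (sVol_image_sFam_pUnit p ⊤ (pUnit_mem_top p) j vQ k).2⟩

omit hp in
/-- `(sData₀ p).map (sFamDep c) ∈ ^{n,∘}ℜ^LGP` of `sFull₀`. [folklore] -/
theorem map_sFamDep_mem_RLGP₀ (c : toyIndex.Label → ℚˣ) (n : ℤ) :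
    (sData₀ p).map (sFamDep p c) ∈ (sFull₀ p).toLatticeSituation.RLGP n := by
  show (sData₀ p).map (sFamDep p c) ∈ MRData.RLGP (sData₀ p)
  exact (MRData.mem_RLGP_iff _ _).2 ⟨sFamDep p c, sFamDep_mem_closure p c, rfl⟩

/-- The splitting monoid of `(sData₀ p).map (sFamDep cQ)` is the q-datum (same star action as for `sData`). [folklore] -/
theorem map_cQ_Psi₀ : ((sData₀ p).map (sFamDep p (cQ p))).Ψ = qDatum p :=
  funext fun v => funext fun hv => starAut_cQ_Psi p v hv

/-- **Packaged for the per-row settings over `sFull₀`**: an element of `^{n,∘}ℜ^LGP` whose splitting monoid IS the q-pilot's Kummer datum.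
[folklore] -/
theorem exists_mem_RLGP₀_Psi_eq_qDatum (n : ℤ) :
    ∃ D' ∈ (sFull₀ p).toLatticeSituation.RLGP n, D'.Ψ = qDatum p :=
  ⟨_, map_sFamDep_mem_RLGP₀ p (cQ p) n, map_cQ_Psi₀ p⟩

/-! ## 5. The one-point frame `{0}` for the junk label (appendix, same seat, append-only) -/

omit hp in
/-- **The ZERO FRAME** on a packet of the scaling shells: the only hull-set is `{0}`, the relatively compact sets are the subsets of `{0}`,
every set «admits a hull». For per-row settings over `sFull₀`: take `frame 0 vQ := zeroFrame p 0 vQ`, glue `{0}` and `ρ X 0 vQ := {0}` at the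
junk label `0` (then `hul_adm` holds by `sData₀_adm_zero`, `qRegion_mem` by `zero_mem_zeroFrame_hul`, (hρ) at label `0` by `image_zero_eq`).
[claim: Mochizuki2012, status: disputed] -/
def zeroFrame (j : toyIndex.Label) (vQ : toyIndex.VQ) : HullFrame ((scalingShells p).Packet j vQ) where
  Hul := {{0}}
  IsBounded := fun U => U ⊆ {0}
  HasHull := fun _ => True
  hul_bounded := fun H hH => by rw [Set.mem_singleton_iff.1 hH]
  bounded_mono := fun _ _ hUU' hU' => hUU'.trans hU'
  exists_hul := fun U hU => ⟨{0}, rfl, hU⟩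
  hull_mem := fun U hU _ => by
    have heq : ⋂₀ {H | H ∈ ({{0}} : Set (Set ((scalingShells p).Packet j vQ))) ∧ U ⊆ H} = {0} := by
      refine Set.Subset.antisymm (Set.sInter_subset_of_mem ⟨rfl, hU⟩) (Set.subset_sInter ?_)
      rintro H ⟨hH, -⟩
      rw [Set.mem_singleton_iff.1 hH]
    rw [heq]
    rfl

omit hp in
/-- The hull-sets of the zero frame are exactly `{0}`. [folklore] -/
theorem mem_zeroFrame_hul_iff (j : toyIndex.Label) (vQ : toyIndex.VQ) (H : Set ((scalingShells p).Packet j vQ)) :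
    H ∈ (zeroFrame p j vQ).Hul ↔ H = {0} := Set.mem_singleton_iff

omit hp in
/-- `{0}` is a hull-set of the zero frame. [folklore] -/
theorem zero_mem_zeroFrame_hul (j : toyIndex.Label) (vQ : toyIndex.VQ) :
    ({0} : Set ((scalingShells p).Packet j vQ)) ∈ (zeroFrame p j vQ).Hul := rfl

omit hp in
/-- Every hull-set of the zero frame is admissible for `sData₀` (the `hul_adm` clause at the junk label). [folklore] -/
theorem sData₀_adm_of_mem_zeroFrame_hul (j : toyIndex.Label) (vQ : toyIndex.VQ) (H : Set ((scalingShells p).Packet j vQ))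
    (hH : H ∈ (zeroFrame p j vQ).Hul) : (sData₀ p).Adm j vQ H := by
  rw [(mem_zeroFrame_hul_iff p j vQ H).1 hH]
  exact sData₀_adm_zero p j vQ

omit hp in
/-- The hull of `{0}` in the zero frame is `{0}`; `{0}` is bounded and admits a hull. [folklore] -/
theorem zeroFrame_hull_zero (j : toyIndex.Label) (vQ : toyIndex.VQ) :
    (zeroFrame p j vQ).hull {0} = {0} ∧ (zeroFrame p j vQ).IsBounded {0} ∧ (zeroFrame p j vQ).HasHull {0} := by
  refine ⟨?_, subset_rfl, trivial⟩
  have hb : (zeroFrame p j vQ).IsBounded {0} := subset_rfl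
  rw [HullFrame.hull, if_pos hb]
  show ⋂₀ {H | H ∈ ({{0}} : Set (Set ((scalingShells p).Packet j vQ))) ∧ {0} ⊆ H} = {0}
  refine Set.Subset.antisymm (Set.sInter_subset_of_mem ⟨rfl, subset_rfl⟩) (Set.subset_sInter ?_)
  rintro H ⟨hH, -⟩
  rw [Set.mem_singleton_iff.1 hH]

omit hp in
/-- Every linear packet automorphism (in particular every element of `⟨(Ind1) ∪ (Ind2)⟩` and every possible-image translate) maps the
hull-sets of the zero frame to hull-sets of the zero frame. [folklore] -/
theorem image_mem_zeroFrame_hul (j : toyIndex.Label) (vQ : toyIndex.VQ)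
    (Φ : (scalingShells p).Packet j vQ ≃ₗ[ℚ] (scalingShells p).Packet j vQ) (H : Set ((scalingShells p).Packet j vQ))
    (hH : H ∈ (zeroFrame p j vQ).Hul) : Φ '' H ∈ (zeroFrame p j vQ).Hul := by
  rw [(mem_zeroFrame_hul_iff p j vQ H).1 hH, image_zero_eq]
  rfl

end Summit.ABC.IUTFork.Repair.ScalarShellsThm311Zero

end
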